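import Literature.MathematicalPhysics.QuantumFieldTheory.Balaban1983to89.B9Eq326ConjugatedDeltaAResolvent

/-!
# `Balaban1983to89.B9Eq3126ConjugatedQG1QLetters` — T. Bałaban, *Propagators for lattice gauge theories in a background field*, Commun. Math. Phys. **99**
# (1985) 389–434 [Balaban1985BackgroundPropagators] (3.126) p. 420 (`H₁ = G₁Q*(QG₁Q*)⁻¹`, `𝔊 = G₁ − H₁QG₁`), (3.26) p. 395, (3.49) p. 399, Thm 3.11 p. 416, with
# [Balaban1985Variational] (45) p. 285, (110)–(111) p. 294: **THE CONJUGATED SECOND GRAM OPERATOR `X₁,κ = Q_κG₁,κQ′_κ` AGAINST `X₁ = QG₁Q†` — size of the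
# difference, perturbed coercivity, and `‖c₁,κ‖ ≤ 2∕μ₁` for any inverse of `X₁,κ`** — abstract finite-dimensional `𝕜`-Hilbert letters over this lineage's
# `B9Eq326ConjugatedDeltaAResolvent` (the resolvent comparison `‖G₁,κ − G₁‖`): the QIL (`B9Eq349ConjugatedQGGQInvLetters`) twin with ONE inverse `G₁` in place
# of `G′²`; the Combes–Thomas input for the `L²` block decay of `(QG₁Q*)⁻¹`, the LAST of the four primitive rows of the NE9 owner's plan v10∕v11
# (`G′` ✓, `(Q′G′²Q′*)⁻¹` ✓, `G₁` (road ΔA-CT), `(QG₁Q*)⁻¹`)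

statement-level skeleton of published theorems with citation tags; proofs where landed; nothing here is a claim about the Yang–Mills mass gap

CITATION HEADER (lean-in-tree rule).  Audit cell `pub-balaban`, sub-cell `t4`, BINDER row NE9; filed by NE9 formalisation-swarm leaf prover 03
(`b2b-balaban-t4-ne9-formalise-leaf-03`, gen 75).  Imports this lineage's `B9Eq326ConjugatedDeltaAResolvent` only.  Sources READ first-hand: [Balaban1985BackgroundPropagators]
p. 420 (3.126), p. 395 (3.26), p. 399 (3.49), p. 416 Thm 3.11; [Balaban1985Variational] p. 285 (45) *«QG₁Q* … positive»*, p. 294 (110)–(111).  The conjugation is the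
ROUTE's Combes–Thomas substitute; nothing of print's is asserted; the lower bound `μ₁` of `QG₁Q*` ([B11] (45) ∕ Thm 3.11) is DISPLAYED.

WHAT IS PROVED (sorry-free; proof lane — no `def`; [folklore] Hilbert-space bookkeeping).  Letters as in `B9Eq326ConjugatedDeltaAResolvent` §3 plus the Gram
data `hX1 : μ₁‖g‖² ≤ re⟪g, Q(G(Q†g))⟫` and `c₁,κ` with `Q_κ(G_κ(Q′_κ(c₁,κv))) = v`.
* **`norm_X1k_sub_X1_le`** — `‖Q_κ(G_κ(Q′_κg)) − Q(G(Q†g))‖ ≤ s₁·‖g‖`, `s₁ = β(4∕γ)(2C_Q + 1) + C_Q(C_Q + 1)·r`, `r` = the resolvent-comparison constant of DAR.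
* **`re_inner_X1k_ge`** — `(μ₁ − s₁)‖g‖² ≤ re⟪g, Q_κ(G_κ(Q′_κg))⟫`.
* **`norm_c1k_le`** — on the window `s₁ ≤ μ₁∕2`: `‖c₁,κv‖ ≤ (2∕μ₁)‖v‖`.
HONEST SCOPE.  Abstract; `γ`, `C_P`, `C_Q`, `μ₁` displayed; no lattice, no rate, no number; NOT NE9 (cell pub-balaban: NE9 NOT PRINTED ∕ NOT PROVED; «NE9 ⇐ the
named binders»; row WALLED ON A MODEL (O-NE9-1; #5 UNRULED); spine PROVED 0∕9; rung (B)+1 on a finite T⁴ — NOT infinite volume, NOT mass gap, NOT BetaPertH, NOT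
Clay; HONEST DEPENDENCY: continuum YM on T⁴ ⇐ BetaPertH ∧ nine spine estimates (0/9 proved); BetaPertH ⇐ (D1) ∧ (D4) ∧ CAP+tail).  NEW file; nothing modified.
Net new unproved facts: 0.
-/

noncomputable section

open scoped InnerProductSpace ComplexConjugate

namespace Literature.MathematicalPhysics.QuantumFieldTheory.Balaban1983to89.B9Eq3126ConjugatedQG1QLetters

open B9Eq326ConjugatedDeltaALetters (norm_Gk_le_projected norm_G_le_projected)
open B9Eq326ConjugatedDeltaAResolvent (norm_Gk_sub_G_le norm_adjQ_le)

variable {𝕜 : Type*} [RCLike 𝕜]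
  {E : Type*} [NormedAddCommGroup E] [InnerProductSpace 𝕜 E] [FiniteDimensional 𝕜 E]
  {P : Type*} [NormedAddCommGroup P] [InnerProductSpace 𝕜 P] [FiniteDimensional 𝕜 P]
  {S : Type*} [NormedAddCommGroup S] [InnerProductSpace 𝕜 S] [FiniteDimensional 𝕜 S]
  {F : Type*} [NormedAddCommGroup F] [InnerProductSpace 𝕜 F] [FiniteDimensional 𝕜 F]

variable (B₁ : E →ₗ[𝕜] P) (B₂ : E →ₗ[𝕜] S) (R : S →ₗ[𝕜] S) (Q : E →ₗ[𝕜] F) (K H G : E →ₗ[𝕜] E) (a γ β βK pK ρ CP CQ μ₁ : ℝ)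
  (B₁k : E →ₗ[𝕜] P) (B₁k' : P →ₗ[𝕜] E) (B₂k : E →ₗ[𝕜] S) (B₂k' : S →ₗ[𝕜] E) (Rk : S →ₗ[𝕜] S) (Qk : E →ₗ[𝕜] F) (Qk' : F →ₗ[𝕜] E)
  (Kk Hk Gk : E →ₗ[𝕜] E)
  (ha : 0 ≤ a) (hγ : 0 < γ) (hγ1 : γ ≤ 1) (hβ : 0 ≤ β) (hβ1 : β ≤ 1) (hβK : 0 ≤ βK) (hρ : 0 ≤ ρ) (hρ8 : ρ ≤ 1 / 8) (hCP : 0 ≤ CP) (hCQ : 0 ≤ CQ)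
  (hRsq : ∀ s, RCLike.re ⟪s, R s⟫_𝕜 = ‖R s‖ ^ 2) (hR1 : ∀ s, ‖R s‖ ≤ ‖s‖) (hRsa : ∀ x y, ⟪R x, y⟫_𝕜 = ⟪x, R y⟫_𝕜)
  (hH : ∀ f, H f = LinearMap.adjoint B₁ (B₁ f) + LinearMap.adjoint B₂ (R (B₂ f)) + K f + ((a : ℝ) : 𝕜) • LinearMap.adjoint Q (Q f))
  (coercive : ∀ f, γ * ‖f‖ ^ 2 ≤ RCLike.re ⟪f, H f⟫_𝕜)
  (hKre : ∀ f, -(pK * ‖f‖ ^ 2) ≤ RCLike.re ⟪f, K f⟫_𝕜)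
  (hP : ∀ f, ‖B₂ f - R (B₂ f)‖ ≤ CP * ‖f‖) (hQ : ∀ f, ‖Q f‖ ≤ CQ * ‖f‖)
  (dB₁ : ∀ f, ‖B₁k f - B₁ f‖ ≤ β * ‖f‖) (dB₁' : ∀ p, ‖B₁k' p - LinearMap.adjoint B₁ p‖ ≤ β * ‖p‖)
  (dB₂ : ∀ f, ‖B₂k f - B₂ f‖ ≤ β * ‖f‖) (dB₂' : ∀ s, ‖B₂k' s - LinearMap.adjoint B₂ s‖ ≤ β * ‖s‖)
  (dR : ∀ s, ‖Rk s - R s‖ ≤ ρ * ‖s‖)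
  (dQ : ∀ f, ‖Qk f - Q f‖ ≤ β * ‖f‖) (dQ' : ∀ g, ‖Qk' g - LinearMap.adjoint Q g‖ ≤ β * ‖g‖)
  (dK : ∀ f, ‖Kk f - K f‖ ≤ βK * ‖f‖)
  (small : pK / 2 + (21 + 3 * a) * β ^ 2 + 4 * β * CP + 2 * ρ * CP ^ 2 + βK ≤ γ / 4)
  (hHk : ∀ f, Hk f = B₁k' (B₁k f) + B₂k' (Rk (B₂k f)) + Kk f + ((a : ℝ) : 𝕜) • Qk' (Qk f))
  (hHG : ∀ v, H (G v) = v) (hHkGk : ∀ v, Hk (Gk v) = v) (hGkHk : ∀ s, Gk (Hk s) = s)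

include ha hγ hγ1 hβ hβ1 hβK hρ hρ8 hCP hCQ hRsq hR1 hRsa hH coercive hKre hP hQ dB₁ dB₁' dB₂ dB₂' dR dQ dQ' dK small hHk hHG hHkGk hGkHk in
/-- **THE CONJUGATED SECOND GRAM OPERATOR AGAINST THE SECOND GRAM OPERATOR**: `‖Q_κ(G_κ(Q′_κg)) − Q(G(Q†g))‖ ≤ s₁‖g‖`,
`s₁ = β(4∕γ)(2C_Q + 1) + C_Q(C_Q + 1)·r` — `X₁,κ − X₁ = (Q_κ − Q)G_κQ′_κ + Q(G_κ − G)Q′_κ + QG(Q′_κ − Q†)`, `‖G_κ‖ ≤ 4∕γ`, `‖Q′_κ‖ ≤ C_Q + 1`, `‖G‖ ≤ 4∕γ`,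
`‖G_κ − G‖ ≤ r` (`norm_Gk_sub_G_le`). [folklore] [cite: Balaban1985BackgroundPropagators, (3.126) p.420, (3.49) p.399; Balaban1985Variational, (45) p.285] -/
theorem norm_X1k_sub_X1_le (g : F) :
    ‖Qk (Gk (Qk' g)) - Q (G (LinearMap.adjoint Q g))‖ ≤
      (β * (4 / γ) * (2 * CQ + 1) + CQ * (CQ + 1) *
        (β * (4 / γ * (2 * (8 / γ) + (8 / γ + 4 / γ) + 2 * ((8 / γ + 4 / γ * CP) + 4 / γ) + a * CQ * (4 / γ) + a * (CQ + 1) * (4 / γ))) +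
          ρ * ((8 / γ + 4 / γ * CP) * ((8 / γ + 4 / γ * CP) + 4 / γ)) + βK * (4 / γ) ^ 2)) * ‖g‖ := by
  have hr0 : 0 ≤ β * (4 / γ * (2 * (8 / γ) + (8 / γ + 4 / γ) + 2 * ((8 / γ + 4 / γ * CP) + 4 / γ) + a * CQ * (4 / γ) + a * (CQ + 1) * (4 / γ))) +
      ρ * ((8 / γ + 4 / γ * CP) * ((8 / γ + 4 / γ * CP) + 4 / γ)) + βK * (4 / γ) ^ 2 := by positivity
  set r := β * (4 / γ * (2 * (8 / γ) + (8 / γ + 4 / γ) + 2 * ((8 / γ + 4 / γ * CP) + 4 / γ) + a * CQ * (4 / γ) + a * (CQ + 1) * (4 / γ))) +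
      ρ * ((8 / γ + 4 / γ * CP) * ((8 / γ + 4 / γ * CP) + 4 / γ)) + βK * (4 / γ) ^ 2 with hr
  have small0 : pK / 2 ≤ γ / 4 := by
    have : 0 ≤ (21 + 3 * a) * β ^ 2 + 4 * β * CP + 2 * ρ * CP ^ 2 + βK := by positivity
    linarith
  have e : Qk (Gk (Qk' g)) - Q (G (LinearMap.adjoint Q g)) =
      (Qk (Gk (Qk' g)) - Q (Gk (Qk' g))) + Q (Gk (Qk' g) - G (Qk' g)) + Q (G (Qk' g - LinearMap.adjoint Q g)) := by
    simp only [map_sub]; abel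
  have nQ' := norm_adjQ_le Q CQ hCQ hQ g
  have nQk' : ‖Qk' g‖ ≤ (CQ + 1) * ‖g‖ := by
    have := norm_le_norm_add_norm_sub' (Qk' g) (LinearMap.adjoint Q g)
    have h := dQ' g
    nlinarith [nQ', hβ1, norm_nonneg g]
  have nGk := norm_Gk_le_projected B₁ B₂ R Q K H a γ β βK pK ρ CP B₁k B₁k' B₂k B₂k' Rk Qk Qk' Kk Hk Gk ha hγ hβ hρ hCP hRsq hR1 hH coercive hKre
    dB₁ dB₁' dB₂ dB₂' dR dQ dQ' dK small hHk hHkGk hρ8 hP (Qk' g)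
  have nG := norm_G_le_projected B₁ B₂ R Q K H G a γ pK CP ha hγ hCP hRsq hR1 hH coercive hKre small0 hHG hP (Qk' g - LinearMap.adjoint Q g)
  have nres := norm_Gk_sub_G_le B₁ B₂ R Q K H G a γ β βK pK ρ CP CQ B₁k B₁k' B₂k B₂k' Rk Qk Qk' Kk Hk Gk ha hγ hγ1 hβ hβ1 hβK hρ hρ8 hCP hCQ hRsq
    hR1 hRsa hH coercive hKre hP hQ dB₁ dB₁' dB₂ dB₂' dR dQ dQ' dK small hHk hHG hHkGk hGkHk (Qk' g)
  have t1 : ‖Qk (Gk (Qk' g)) - Q (Gk (Qk' g))‖ ≤ β * (4 / γ * ((CQ + 1) * ‖g‖)) :=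
    (dQ _).trans (mul_le_mul_of_nonneg_left (nGk.trans (mul_le_mul_of_nonneg_left nQk' (by positivity))) hβ)
  have t2 : ‖Q (Gk (Qk' g) - G (Qk' g))‖ ≤ CQ * (r * ((CQ + 1) * ‖g‖)) :=
    (hQ _).trans (mul_le_mul_of_nonneg_left (nres.trans (mul_le_mul_of_nonneg_left nQk' hr0)) hCQ)
  have t3 : ‖Q (G (Qk' g - LinearMap.adjoint Q g))‖ ≤ CQ * (4 / γ * (β * ‖g‖)) :=
    (hQ _).trans (mul_le_mul_of_nonneg_left (nG.trans (mul_le_mul_of_nonneg_left (dQ' g) (by positivity))) hCQ)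
  calc ‖Qk (Gk (Qk' g)) - Q (G (LinearMap.adjoint Q g))‖
      ≤ ‖Qk (Gk (Qk' g)) - Q (Gk (Qk' g))‖ + ‖Q (Gk (Qk' g) - G (Qk' g))‖ + ‖Q (G (Qk' g - LinearMap.adjoint Q g))‖ := by
        rw [e]; exact (norm_add_le _ _).trans (add_le_add (norm_add_le _ _) le_rfl)
    _ ≤ β * (4 / γ * ((CQ + 1) * ‖g‖)) + CQ * (r * ((CQ + 1) * ‖g‖)) + CQ * (4 / γ * (β * ‖g‖)) := add_le_add (add_le_add t1 t2) t3
    _ = (β * (4 / γ) * (2 * CQ + 1) + CQ * (CQ + 1) * r) * ‖g‖ := by ring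

include ha hγ hγ1 hβ hβ1 hβK hρ hρ8 hCP hCQ hRsq hR1 hRsa hH coercive hKre hP hQ dB₁ dB₁' dB₂ dB₂' dR dQ dQ' dK small hHk hHG hHkGk hGkHk in
/-- **PERTURBED COERCIVITY OF THE CONJUGATED SECOND GRAM OPERATOR**: a lower bound `μ₁‖g‖² ≤ re⟪g, QG₁Q†g⟫` ([B11] (45) ∕ Thm 3.11, displayed) passes to
`(μ₁ − s₁)‖g‖² ≤ re⟪g, Q_κ(G_κ(Q′_κg))⟫`. [folklore] [cite: Balaban1985Variational, (45) p.285; Balaban1985BackgroundPropagators, Thm 3.11 p.416, (3.126) p.420] -/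
theorem re_inner_X1k_ge (hX1 : ∀ g : F, μ₁ * ‖g‖ ^ 2 ≤ RCLike.re ⟪g, Q (G (LinearMap.adjoint Q g))⟫_𝕜) (g : F) :
    (μ₁ - (β * (4 / γ) * (2 * CQ + 1) + CQ * (CQ + 1) *
        (β * (4 / γ * (2 * (8 / γ) + (8 / γ + 4 / γ) + 2 * ((8 / γ + 4 / γ * CP) + 4 / γ) + a * CQ * (4 / γ) + a * (CQ + 1) * (4 / γ))) +
          ρ * ((8 / γ + 4 / γ * CP) * ((8 / γ + 4 / γ * CP) + 4 / γ)) + βK * (4 / γ) ^ 2))) * ‖g‖ ^ 2 ≤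
      RCLike.re ⟪g, Qk (Gk (Qk' g))⟫_𝕜 := by
  have h1 := hX1 g
  have h2 : RCLike.re ⟪g, Qk (Gk (Qk' g))⟫_𝕜 = RCLike.re ⟪g, Q (G (LinearMap.adjoint Q g))⟫_𝕜 +
      RCLike.re ⟪g, Qk (Gk (Qk' g)) - Q (G (LinearMap.adjoint Q g))⟫_𝕜 := by
    rw [← map_add, ← inner_add_right, add_sub_cancel]
  have h3 := (abs_le.1 (RCLike.abs_re_le_norm ⟪g, Qk (Gk (Qk' g)) - Q (G (LinearMap.adjoint Q g))⟫_𝕜)).1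
  have h4 := norm_inner_le_norm (𝕜 := 𝕜) g (Qk (Gk (Qk' g)) - Q (G (LinearMap.adjoint Q g)))
  have h5 := mul_le_mul_of_nonneg_left
    (norm_X1k_sub_X1_le B₁ B₂ R Q K H G a γ β βK pK ρ CP CQ B₁k B₁k' B₂k B₂k' Rk Qk Qk' Kk Hk Gk ha hγ hγ1 hβ hβ1 hβK hρ hρ8 hCP hCQ hRsq hR1 hRsa hH
      coercive hKre hP hQ dB₁ dB₁' dB₂ dB₂' dR dQ dQ' dK small hHk hHG hHkGk hGkHk g) (norm_nonneg g)
  nlinarith [h1, h2, h3, h4, h5, norm_nonneg g]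

include ha hγ hγ1 hβ hβ1 hβK hρ hρ8 hCP hCQ hRsq hR1 hRsa hH coercive hKre hP hQ dB₁ dB₁' dB₂ dB₂' dR dQ dQ' dK small hHk hHG hHkGk hGkHk in
/-- **`‖c₁,κv‖ ≤ (2∕μ₁)‖v‖`** for ANY `c₁,κ` with `Q_κ(G_κ(Q′_κ(c₁,κv))) = v` (at the chain: the conjugate of `(QG₁Q*)⁻¹`), on the window `s₁ ≤ μ₁∕2` — [B11] (45)'s
kernel-decay half, Combes–Thomas form, abstract. [folklore] [cite: Balaban1985Variational, (45) p.285; Balaban1985BackgroundPropagators, (3.126) p.420, Thm 3.11 p.416] -/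
theorem norm_c1k_le {μ₁ : ℝ} (hμ₁ : 0 < μ₁) (hX1 : ∀ g : F, μ₁ * ‖g‖ ^ 2 ≤ RCLike.re ⟪g, Q (G (LinearMap.adjoint Q g))⟫_𝕜)
    (ck : F →ₗ[𝕜] F) (hck : ∀ v, Qk (Gk (Qk' (ck v))) = v)
    (small2 : β * (4 / γ) * (2 * CQ + 1) + CQ * (CQ + 1) *
        (β * (4 / γ * (2 * (8 / γ) + (8 / γ + 4 / γ) + 2 * ((8 / γ + 4 / γ * CP) + 4 / γ) + a * CQ * (4 / γ) + a * (CQ + 1) * (4 / γ))) +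
          ρ * ((8 / γ + 4 / γ * CP) * ((8 / γ + 4 / γ * CP) + 4 / γ)) + βK * (4 / γ) ^ 2) ≤ μ₁ / 2) (v : F) :
    ‖ck v‖ ≤ 2 / μ₁ * ‖v‖ := by
  have h1 := re_inner_X1k_ge B₁ B₂ R Q K H G a γ β βK pK ρ CP CQ μ₁ B₁k B₁k' B₂k B₂k' Rk Qk Qk' Kk Hk Gk ha hγ hγ1 hβ hβ1 hβK hρ hρ8 hCP hCQ hRsq
    hR1 hRsa hH coercive hKre hP hQ dB₁ dB₁' dB₂ dB₂' dR dQ dQ' dK small hHk hHG hHkGk hGkHk hX1 (ck v)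
  rw [hck] at h1
  have h2 : RCLike.re ⟪ck v, v⟫_𝕜 ≤ ‖ck v‖ * ‖v‖ := (RCLike.re_le_norm _).trans (norm_inner_le_norm _ _)
  have h3 : μ₁ / 2 * ‖ck v‖ ^ 2 ≤ ‖ck v‖ * ‖v‖ := by nlinarith [h1, h2, sq_nonneg ‖ck v‖]
  by_cases hx : ck v = 0
  · rw [hx, norm_zero]; positivity
  · have hxpos : 0 < ‖ck v‖ := norm_pos_iff.mpr hx
    rw [div_mul_eq_mul_div, le_div_iff₀ hμ₁]
    nlinarith [h3, hxpos]

end Literature.MathematicalPhysics.QuantumFieldTheory.Balaban1983to89.B9Eq3126ConjugatedQG1QLetters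

end
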